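import Summits.ResolutionOfSingularities.ResolutionOfSingularities.Theses.UniversalCells
import Summits.ResolutionOfSingularities.ResolutionOfSingularities.Theorems.LocalToGlobal.Negative.LoadBearing
import Summits.ResolutionOfSingularities.ResolutionOfSingularities.Theorems.LocalToGlobal.Negative.ResolutionsNotRigid
import Summits.ResolutionOfSingularities.ResolutionOfSingularities.Theorems.UniversalCellsLocalToGlobalReductions
import Summits.ResolutionOfSingularities.ResolutionOfSingularities.Theorems.UniversalCellsLocalToGlobalTwoModelPatchingAt
import HarnessLib

/-!
# Disproof of `LocalToGlobal` (crux stmt-ResolutionOfSingularities-15232) — findings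

Standing disprover's work file (cdisprove seat `refuter-cdisprove-stmt-ResolutionOfSingularities-15232-0`,
cycle 1, 2026-08-17). Crux (route `UniversalCells`, rank 4):
`LocalToGlobal : ∀ p prime, H_p → R_p` with, over `𝔽_p = ZMod p`,
`H_p` := every point of every integral separated finite-type `𝔽_p`-scheme has an open neighbourhood
with a resolution, `R_p` := every such scheme has a resolution (weak form: proper birational from a
regular scheme). Prose lives in docstrings only; every `theorem` below is sorry-free unless marked
NEAR-MISS (none this cycle).

## Index of findings

* §1 SHAPE / IRREFUTABILITY (landed before this seat: `Negative/LoadBearing.lean`, p149732, cited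
  by `example`s): `LocalToGlobal ↔ ∀ p (H_p ↔ R_p)`; `¬LocalToGlobal ↔ ∃ p, H_p ∧ ¬R_p`, i.e. a kill
  must PROVE local resolution of everything over some `𝔽_p` and EXHIBIT a non-resolvable integral
  `𝔽_p`-variety (of dimension `≥ 4` modulo `CossartPiltant2019`) — it refutes the summit. VERDICT OF
  THIS CYCLE: no unconditional kill is possible by counterexample search, small models or barrier
  reduction; nothing finite decides either side.
* §2 LOAD-BEARING HYPOTHESES. Landed guards (LoadBearing §3): `IsIntegral` on the consequent
  (`Spec 𝔽_p[ε]`), `LocallyOfFiniteType` on the consequent (`Spec 𝔽_p[X]⁺`), `IsIntegral` on the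
  antecedent (dropping it makes the crux VACUOUS). New this cycle: the modulus guard `p.Prime` is NOT
  refutation-bearing — `p = 1` makes both sides vacuous (`cruxBody_at_one`, proved), composite `p`
  reduces to its prime factors on integral schemes, `p = 0` is the arithmetic (`ℤ`-scheme) analogue,
  open as well; `IsSeparated` / `QuasiCompact` on either side: no cheap witness exists (a
  non-separated or non-quasi-compact integral lft scheme whose opens are resolvable but which is not
  is again a GLUING counterexample, i.e. crux-hard) — recorded as "possibly unnecessary, untestable".
* §3 REFUTED NATURAL STRENGTHENINGS (NEW; LANDED as `Negative/ResolutionsNotRigid.lean`, p153385): the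
  three rigidity properties of resolutions each of which would make `H_p ⇒ R_p` immediate by
  restriction-and-gluing are FALSE over every field, witness the blowing up of `𝔸²` at the origin
  (kernel-checked from the tree's `AffineBlowup*` files): (i) a resolution of a REGULAR variety need
  not be an iso (`exists_isResolution_of_isRegular_not_isIso`); (ii) resolutions are not unique up to
  `X`-isomorphism (`resolutions_not_unique`; Kollár 2007 Rem. 3.28: gluing needs agreement on
  overlaps); (iii) weak ≠ strong: a resolution need not be an iso over the regular locus
  (`resolution_not_isIso_over_regularLocus`) — the formal content of census F1 / lead (A3): the local
  resolutions of `H_p` cannot be cut back to the identity over `Reg` and patched. Engine: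
  `affineBlowup_base_not_injective` (quasi-regular centre of length `≥ 2`, `R/(x)` a domain ⇒ `π` not
  injective on points: two points `T = 0, 1` of the line `Spec (R/(x))[T] ⊆ D₊(x_i t)` over `V(x)`).
* §4 TARGETS — line `birth` v3 (`Lines/birth.lean`, lead c1; payload `stuck_stubs = []`): every
  critical-path stub is implied by `Hironaka1964 ∧ summit` (`targets_of_hironaka_of_summit`: cover
  patching over an arbitrary field needs only resolvability of `X`, char 0 by Hironaka, char `p` by
  the summit; the ATOM `stub_twoModelPatching_primeField_trdeg_four` by the landed
  `twoModelPatchingAt_of_globallyResolvable`; the remainder `stub_localToGlobalDimGeFive` verbatim);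
  `stub_cossartPiltant2019` IS the printed fact; the certificate stub
  `stub_twoModelPatchingAt_of_resolvable_dimLe` is a theorem-to-be (resolve the join) with no junk
  instance (`ProperModel` pins integrality, properness, generic point and function field; an empty
  `ProperModel k K` type only makes it vacuous). Joint sufficiency is kernel-checked in the skeleton
  (`LocalToGlobal_of` via the landed glue `LocalToGlobal_of_subs`, p152116) — no smuggled gap. Hence
  NO `stub-false` / `stub-misstated` is available on this line: its stubs can only be attacked
  together with resolution of 4-folds over `𝔽_p` (`DimensionFourFrontier`).
* §5 WHY IT RESISTS / NEXT REGIMES: see the closing docstring `resists_because`.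
-/

noncomputable section

-- single-problem summit: the doubled namespace component `ResolutionOfSingularities` is forced
set_option linter.dupNamespace false

open CategoryTheory AlgebraicGeometry Literature.AlgebraicGeometry.Resolution HomogeneousLocalization
open Summit.ResolutionOfSingularities.ResolutionOfSingularities.Theses.UniversalCells
  (LocalToGlobal PrimeFieldThesis)
open Summit.ResolutionOfSingularities.ResolutionOfSingularities.Theorems.LocalToGlobal

namespace Summit.ResolutionOfSingularities.ResolutionOfSingularities.Cruxes.LocalToGlobal.Disproof

universe u

/-! ## §1 Shape and irrefutability (landed: `Negative/LoadBearing.lean`, p149732) -/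

/-- The crux is, prime by prime, `H_p ↔ R_p` (the converse is restriction to `U = ⊤`). -/
example : LocalToGlobal ↔ ∀ p : ℕ, p.Prime →
    ((∀ (X : Scheme.{0}) (f : X ⟶ Spec (.of (ZMod p))), IsSeparated f → LocallyOfFiniteType f →
        QuasiCompact f → IsIntegral X →
          ∀ x : X, ∃ U : X.Opens, x ∈ U ∧ Scheme.HasResolution (U : Scheme.{0})) ↔
      ∀ (X : Scheme.{0}) (f : X ⟶ Spec (.of (ZMod p))), IsSeparated f → LocallyOfFiniteType f →
        QuasiCompact f → IsIntegral X → Scheme.HasResolution X) :=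
  Negative.localToGlobal_iff_forall_iff

/-- A kill is a prime with `H_p ∧ ¬R_p` … -/
example : ¬ LocalToGlobal ↔ ∃ p : ℕ, p.Prime ∧
    (∀ (X : Scheme.{0}) (f : X ⟶ Spec (.of (ZMod p))), IsSeparated f → LocallyOfFiniteType f →
        QuasiCompact f → IsIntegral X →
          ∀ x : X, ∃ U : X.Opens, x ∈ U ∧ Scheme.HasResolution (U : Scheme.{0})) ∧
    ¬ ∀ (X : Scheme.{0}) (f : X ⟶ Spec (.of (ZMod p))), IsSeparated f → LocallyOfFiniteType f →
        QuasiCompact f → IsIntegral X → Scheme.HasResolution X :=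
  Negative.not_localToGlobal_iff

/-- … hence refutes the summit. -/
example (h : ¬ LocalToGlobal) : ¬ _root_.ResolutionOfSingularities :=
  Negative.not_resolutionOfSingularities_of_not_localToGlobal h

/-- And the summit proves the crux (lead, p148499). -/
example (h : ∀ p : ℕ, p.Prime → ResolutionInChar.{0} p) : LocalToGlobal :=
  Theorems.localToGlobal_of_resolutionInChar h

/-! ## §2 Load-bearing hypotheses — the modulus guard (new); the other guards are landed -/

/-- `Without p.Prime`, degenerate modulus `p = 1`: `ZMod 1` is the zero ring, `Spec (ZMod 1) = ∅`,
so NO integral scheme maps to it and the consequent (likewise the antecedent) of the crux holds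
vacuously at `p = 1` — dropping primality yields no counterexample of this kind. (Composite `p`:
an integral scheme over `ZMod p` lives over one prime factor; `p = 0`: `ZMod 0 = ℤ`, the arithmetic
local-to-global problem, open as well.) [folklore] -/
theorem cruxBody_at_one :
    ∀ (X : Scheme.{0}) (f : X ⟶ Spec (.of (ZMod 1))), IsSeparated f → LocallyOfFiniteType f →
      QuasiCompact f → IsIntegral X → Scheme.HasResolution X := by
  intro X f _ _ _ hX
  haveI : IsEmpty (Spec (CommRingCat.of (ZMod 1))) :=
    inferInstanceAs (IsEmpty (PrimeSpectrum (ZMod 1)))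
  obtain ⟨x⟩ := hX.nonempty
  exact isEmptyElim (f.base x)

/-- The crux with the modulus guard DROPPED holds at `p = 1` (both sides vacuous). [folklore] -/
theorem localToGlobalWithoutPrime_at_one :
    (∀ (X : Scheme.{0}) (f : X ⟶ Spec (.of (ZMod 1))), IsSeparated f → LocallyOfFiniteType f →
        QuasiCompact f → IsIntegral X →
          ∀ x : X, ∃ U : X.Opens, x ∈ U ∧ Scheme.HasResolution (U : Scheme.{0})) →
      ∀ (X : Scheme.{0}) (f : X ⟶ Spec (.of (ZMod 1))), IsSeparated f → LocallyOfFiniteType f →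
        QuasiCompact f → IsIntegral X → Scheme.HasResolution X :=
  fun _ => cruxBody_at_one

/-! ## §3 Refuted natural strengthenings: resolutions are not rigid (NEW this cycle; LANDED as
`Theorems/LocalToGlobal/Negative/ResolutionsNotRigid.lean`, p153385 — cited below by `example`s) -/

section Strengthenings

variable (k : Type) [Field k]

/-- ENGINE (landed): the blowing up of `Spec R` along a quasi-regular centre of length `≥ 2` with
`R/(x)` a domain is not injective on points, hence not an isomorphism. -/
example {R : Type u} [CommRing R] {r : ℕ} (x : Fin r → R) (i j : Fin r) (hij : j ≠ i)
    (hx : IsQuasiRegular x) [IsDomain (R ⧸ Ideal.span (Set.range x))] :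
    ¬ IsIso (affineBlowup.π (Ideal.span (Set.range x))) :=
  Negative.affineBlowup_not_isIso x i j hij hx

/-- WITNESS (landed): `Bl_{(X₀,X₁)} 𝔸²_k → 𝔸²_k` is a resolution of the regular plane and not an
isomorphism. -/
example : IsResolution (affineBlowup.π
      (Ideal.span (Set.range (MvPolynomial.X : Fin 2 → MvPolynomial (Fin 2) k)))) ∧
    ¬ IsIso (affineBlowup.π
      (Ideal.span (Set.range (MvPolynomial.X : Fin 2 → MvPolynomial (Fin 2) k)))) :=
  Negative.blowupPlane_isResolution_not_isIso k

/-- (i) REFUTED: "a resolution of a regular variety is an isomorphism". -/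
example : ∃ (X : Scheme.{0}) (f : X ⟶ Spec (.of k)), IsSeparated f ∧ LocallyOfFiniteType f ∧
    QuasiCompact f ∧ IsIntegral X ∧ Scheme.IsRegular X ∧
    ∃ (X' : Scheme.{0}) (π : X' ⟶ X), IsResolution π ∧ IsIntegral X' ∧ ¬ IsIso π :=
  Negative.exists_isResolution_of_isRegular_not_isIso k

/-- (ii) REFUTED: "resolutions are unique up to isomorphism over the base" — the property that
would make the Zariski-local resolutions of `H_p` glue for free (Kollár 2007, Rem. 3.28). -/
example : ¬ ∀ (X : Scheme.{0}) (f : X ⟶ Spec (.of k)), IsSeparated f → LocallyOfFiniteType f →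
    QuasiCompact f → IsIntegral X →
    ∀ (X₁ X₂ : Scheme.{0}) (π₁ : X₁ ⟶ X) (π₂ : X₂ ⟶ X), IsResolution π₁ → IsResolution π₂ →
      ∃ e : X₁ ≅ X₂, e.hom ≫ π₂ = π₁ :=
  Negative.resolutions_not_unique k

/-- (iii) REFUTED: "weak ⇒ strong for free" — a resolution need not be an isomorphism over the
regular locus of the base (census F1 / lead (A3): the weak local resolutions of `H_p` cannot be
cut back to the identity over `Reg` and patched with it). -/
example : ¬ ∀ (X : Scheme.{0}) (f : X ⟶ Spec (.of k)), IsSeparated f → LocallyOfFiniteType f →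
    QuasiCompact f → IsIntegral X →
    ∀ (X' : Scheme.{0}) (π : X' ⟶ X), IsResolution π →
      ∀ U : X.Opens, (∀ x : X, x ∈ U → IsRegularLocalRing (X.presheaf.stalk x)) →
        IsIso (π ∣_ U) :=
  Negative.resolution_not_isIso_over_regularLocus k

/-- The same two refutations at the prime field of the crux, every prime `p`. -/
example (p : ℕ) [Fact p.Prime] : ¬ ∀ (X : Scheme.{0}) (f : X ⟶ Spec (.of (ZMod p))),
    IsSeparated f → LocallyOfFiniteType f → QuasiCompact f → IsIntegral X →
    ∀ (X₁ X₂ : Scheme.{0}) (π₁ : X₁ ⟶ X) (π₂ : X₂ ⟶ X), IsResolution π₁ → IsResolution π₂ →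
      ∃ e : X₁ ≅ X₂, e.hom ≫ π₂ = π₁ :=
  Negative.resolutions_not_unique_primeField p

end Strengthenings


/-! ## §4 Targets — line `birth` v3: no stub is refutable short of (Hironaka ∧ summit) -/

section Targets

/-- Statement of `stub_coverPatching_of_trdegLe` (copied verbatim from `Lines/birth.lean` v3). -/
def SigCoverPatching : Prop :=
  ∀ (k : Type) [Field k] (n : ℕ),
    (∀ (K : Type) [Field K] [Algebra k K] [Algebra.EssFiniteType k K], Algebra.trdeg k K ≤ n →
      ∀ M₁ M₂ : ProperModel k K,
        ∃ (N : ProperModel k K) (φ₁ : N.Hom M₁) (φ₂ : N.Hom M₂), φ₁.RegLe ∧ φ₂.RegLe) →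
    ∀ (X : Scheme.{0}) (f : X ⟶ Spec (.of k)) [IsSeparated f] [LocallyOfFiniteType f]
      [QuasiCompact f] [IsIntegral X], topologicalKrullDim X ≤ n → ∀ (U V : X.Opens), U ⊔ V = ⊤ →
      ∀ {Z₁ Z₂ : Scheme.{0}} [IsIntegral Z₁] [IsIntegral Z₂] (π₁ : Z₁ ⟶ X) (π₂ : Z₂ ⟶ X)
        [IsProper π₁] [IsProper π₂], IsBirational π₁ → IsBirational π₂ →
        (∀ z : Z₁, π₁.base z ∈ U → IsRegularLocalRing (Z₁.presheaf.stalk z)) →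
        (∀ z : Z₂, π₂.base z ∈ V → IsRegularLocalRing (Z₂.presheaf.stalk z)) →
          Scheme.HasResolution X

/-- Statement of the ATOM `stub_twoModelPatching_primeField_trdeg_four` (verbatim). -/
def SigAtom : Prop :=
  ∀ (p : ℕ) [Fact p.Prime] (K : Type) [Field K] [Algebra (ZMod p) K]
    [Algebra.EssFiniteType (ZMod p) K], Algebra.trdeg (ZMod p) K = 4 →
    ∀ M₁ M₂ : ProperModel (ZMod p) K,
      ∃ (N : ProperModel (ZMod p) K) (φ₁ : N.Hom M₁) (φ₂ : N.Hom M₂), φ₁.RegLe ∧ φ₂.RegLe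

/-- Statement of the remainder `stub_localToGlobalDimGeFive` (verbatim). -/
def SigDimGeFive : Prop :=
  ∀ p : ℕ, p.Prime → (∀ (X : AlgebraicGeometry.Scheme.{0})
    (f : X ⟶ AlgebraicGeometry.Spec (.of (ZMod p))), AlgebraicGeometry.IsSeparated f →
    AlgebraicGeometry.LocallyOfFiniteType f → AlgebraicGeometry.QuasiCompact f →
    AlgebraicGeometry.IsIntegral X → ∀ x : X, ∃ U : X.Opens, x ∈ U ∧
      Literature.AlgebraicGeometry.Resolution.Scheme.HasResolution
        (U : AlgebraicGeometry.Scheme.{0})) →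
    ∀ (X : AlgebraicGeometry.Scheme.{0}) (f : X ⟶ AlgebraicGeometry.Spec (.of (ZMod p))),
    AlgebraicGeometry.IsSeparated f → AlgebraicGeometry.LocallyOfFiniteType f →
    AlgebraicGeometry.QuasiCompact f → AlgebraicGeometry.IsIntegral X →
    ¬ topologicalKrullDim X ≤ 4 → Literature.AlgebraicGeometry.Resolution.Scheme.HasResolution X

/-- **Every critical-path stub of line `birth` v3 follows from Hironaka's theorem (char 0) and
the summit (char `p`)**: the cover-patching stub concludes `HasResolution X` for a variety over an
arbitrary field and uses nothing else; the atom is two-model patching over `𝔽_p`, which global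
resolvability over `𝔽_p` gives by resolving the join
(`Theorems.twoModelPatchingAt_of_globallyResolvable`, p148137); the remainder is the crux in
dimension `≥ 5`. So no `stub-false` is obtainable without refuting resolution of singularities
itself; the fourth stub `stub_cossartPiltant2019` is the printed theorem `CossartPiltant2019`.
[folklore] -/
theorem targets_of_hironaka_of_summit (hH : Hironaka1964.{0}) (hS : _root_.ResolutionOfSingularities) :
    SigCoverPatching ∧ SigAtom ∧ SigDimGeFive := by
  refine ⟨?_, ?_, ?_⟩
  · intro k _ n _ X f _ _ _ hX _ U V _ Z₁ Z₂ _ _ π₁ π₂ _ _ _ _ _ _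
    -- only resolvability of `X` over `k` is used
    obtain ⟨q, hq⟩ := CharP.exists k
    rcases CharP.char_is_prime_or_zero k q with hprime | rfl
    · exact hS q hprime k X f ‹_› ‹_› ‹_› inferInstance
    · exact hH k X f ‹_› ‹_› ‹_› inferInstance
  · intro p _ K _ _ _ _ M₁ M₂
    refine Theorems.twoModelPatchingAt_of_globallyResolvable p ?_ K M₁ M₂
    intro X f hs hl hq hX
    exact hS p Fact.out (ZMod p) X f hs hl hq inferInstance
  · intro p hp _ X f hs hl hq hX _
    haveI : Fact p.Prime := ⟨hp⟩
    exact hS p hp (ZMod p) X f hs hl hq inferInstance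

/-- In particular the atom alone is summit-implied (no Hironaka needed). [folklore] -/
theorem atom_of_summit (hS : _root_.ResolutionOfSingularities) : SigAtom :=
  fun p _ K _ _ _ _ M₁ M₂ =>
    Theorems.twoModelPatchingAt_of_globallyResolvable p
      (fun X f hs hl hq _ => hS p Fact.out (ZMod p) X f hs hl hq inferInstance) K M₁ M₂

end Targets

/-! ## §5 Why it resists; next regimes -/

/-- **WHY THE CRUX RESISTS (cycle 1).** (1) Logical shape: `¬LocalToGlobal ↔ ∃ p, H_p ∧ ¬R_p`;
both conjuncts are summit-class (local resolution of ALL `𝔽_p`-varieties; a non-resolvable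
`𝔽_p`-variety of dimension `≥ 4`), nothing finite or decidable instantiates either, and every
junk/degenerate instance (`Spec 𝔽_p`, `p = 1`, non-reduced or non-finite-type schemes) is either
excluded by the guards or satisfies both sides. (2) Every natural variant whose conclusion is still
`HasResolution X` for an `𝔽_p`-variety (drop `H_p`, bound the dimension, open patching, two-model
patching, the v3 stubs) is summit-implied, hence equally irrefutable; the refutable variants are
the RIGIDITY strengthenings of §3, and those are now refuted in Lean — they certify that `H_p` is
idle beyond the finite subcover (census F1) rather than killing the crux. (3) Literature: no
counterexample candidate to resolution in char `p` exists in print (catalogued pathologies are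
failures of invariants, not of resolvability); Zariski-local-to-global for bare existence is
open in dim `≥ 4` in every characteristic (Kollár 2007 Ch. 3 (4); Piltant 2013 p. 2).
NEXT REGIMES (for a re-armed cycle): (a) if the lead registers stubs BELOW the atom (Claims A/B of
`closed-point-fibre-freedom`, `FibreFreeRegular p 4`), attack their side conditions (closedness of
bad points, "iso off the closed fibre" spreading) with the §3 engine (blow-ups that are not isos
where claimed); (b) tightness of `RegLe`: exhibit proper models `M₁, M₂` of `𝔽_p(x,y)` with NO
morphism `M₁ → M₂` (so the dominating `N` of two-model patching must be a third model) — needs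
`ProperModel` instances of `ℙ²` / `ℙ¹ × ℙ¹`, not in tree; (c) watch for a restatement of the crux
per scheme (`∀ X, (locally resolvable X) → resolvable X`): still summit-implied, same verdict. -/
theorem resists_because : True := trivial

end Summit.ResolutionOfSingularities.ResolutionOfSingularities.Cruxes.LocalToGlobal.Disproof

end
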